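import Summits.ValiantsHypothesis.ValiantsHypothesis.Theorems.NewtonTauWeak.Negative.LoadBearing

/-!
# `NewtonTauRoot` (stmt-ValiantsHypothesis-18547) — probe, corners, load-bearing hypothesis and
# shape of the ROOT budget (negative lane)

Negative knowledge for the deciding crux
`Summit.ValiantsHypothesis.ValiantsHypothesis.Theses.NewtonUnitEquations.NewtonTauRoot`
(route NewtonUnitEquations, retarget 2026-08-17): KPTT's weak Newton-polygon τ-conjecture
(arXiv:1308.2286 Conj. 1 / Thm 1 threshold) in ROOT form,
`vert (Σ_{i<k} Π_{j<m} f i j) ≤ 2^{a m} (k t + 2)^{b (⌊√m⌋ + 1)}` for `t`-sparse bivariate `f i j`.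
Refuter one-shot crux attack (refuter-rattack-stmt-ValiantsHypothesis-18547-0), reusing the witness
machinery of `DissociatedFixedK/Negative/LoadBearing.lean` (`chainPoly`: monomials on a strictly
convex lattice chain, `vertices_chainPoly`) and `NewtonTauWeak/Negative/*` (`vert`, corners):

* `newtonTauRoot_iff` — the crux by name is literally the root bound on `vert`; `one_le_rootBound`,
  `vert_le_rootBound_of_k_zero`, `vert_le_rootBound_of_m_zero` — the degenerate corners `k = 0`
  (`vert = 0`) and `m = 0` (every product is `1`, `vert ≤ 1`) satisfy the bound for EVERY `a b`
  (no junk case, no missing side condition; `t = 0` forces `f i j = 0`, `t = 1` gives `≤ k` monomials);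
* `not_newtonTauWeak_of_not_newtonTauRoot` — hierarchy in the negative direction: the sharp form
  `NewtonTauWeak` (stmt-5904) implies the root form with the SAME constants, so a kill of the root
  form kills the sharp form (and KPTT Conj. 1); the converse padding is not available;
* `newtonTauRoot_false_without_sparsity` — the only hypothesis `#supp (f i j) ≤ t` is load-bearing
  also for the root budget (`k = m = 1`, `t = 0`, budget `2^a·4^b`, witness `chainPoly` with
  `2^a·4^b + 1` chain monomials);
* `not_newtonTauRootBoundNoK`, `not_newtonTauRootBoundNoT` — neither `k` nor `t` can be dropped from
  the base `k t + 2` even with the root exponent `b(⌊√m⌋+1)` (`m = 1`, budget `2^a·9^b`; `k` chain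
  monomials resp. one `t`-nomial on the chain).
MUTATIONS THAT SURVIVE (information for provers, not refutable by the three standard witness
families — chain monomials, the zonogon `Π_{j<m}(1 + X Y^j)` with `2m` vertices
(`NewtonTauWeak/Negative/Zonogon.lean`), KPTT Example-3 digit grids
(`DissociatedFixedK/Negative/UniformCFalse.lean`)): (i) `a = 0` — unlike the sharp form
(`not_newtonTauBoundNoM`: `2m > 4^b`), the root budget `(kt+2)^{b(⌊√m⌋+1)} ≥ 4^{b(⌊√m⌋+1)}` absorbs
the zonogon, and digit grids give `vert = k ≤ (kt+2)`; the planner's dissociated rung indeed has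
`a = 0, b = 14`; (ii) the `+1` in `⌊√m⌋ + 1` only matters for `m = 0`, where `vert ≤ 1 ≤ 2^0·(kt+2)^0`
anyway.  WHAT A COUNTEREXAMPLE MUST LOOK LIKE: since `vert ≤ #supp ≤ k·t^m`
(`vert_le_card_support`), a refuting family needs `m log t + log k ≫ a m + b √m log(kt)` for all
`a b`, i.e. `t → ∞`, `m → ∞`, `log k = o(√m log t)`, with all but `k m t` of the vertices manufactured
by cancellation BETWEEN products (no-cancellation bound `k m t`, KPTT §2; `k = 1`: `vert ≤ m t`,
Ostrowski).  Through KPTT Thm 1 re-run as in Hrubeš–Yehudayoff, "Shadows of Newton polytopes"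
(CCC 2021, LIPIcs 200:9, Prop. 49 p. 18 / Cor. 50 p. 19; Israel J. Math. 2023) the root form predicts
planar shadow numbers `σ(Newt g) ≤ s^{O(d^{3/4})}` for every polynomial of degree `d` with a circuit of
size `s` (sharp form / Conj. 47: `s^{O(√d log d)}`), e.g. `σ(DS_n) ≤ 2^{O(n^{3/4} log n)}` for the
Birkhoff polytope; known is only `2^{Ω(log² n)} ≤ σ(DS_n) ≤ 2^{O(n)}` (HY Open Problem 1 p. 21: "Is
`σ(DS_n)` exponential in `n`?") — no printed result contradicts the crux (searched 2026-08-17: citers of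
arXiv:1308.2286 and of HY through 2025, `ledger negatives`).
[folklore]
-/

set_option linter.dupNamespace false

namespace Summit.ValiantsHypothesis.ValiantsHypothesis.Theorems.NewtonTauRoot.Negative

open scoped BigOperators
open MvPolynomial Finset
open Summit.ValiantsHypothesis.ValiantsHypothesis.Theses.NewtonUnitEquations (NewtonTauRoot NewtonTauWeak)
open Summit.ValiantsHypothesis.ValiantsHypothesis.Theorems.DissociatedFixedK.Negative
  (chainPt chainPoly chainPt_injective support_chainPoly vertices_chainPoly)
open Summit.ValiantsHypothesis.ValiantsHypothesis.Theorems.NewtonTauWeak.Negative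
  (vert vert_le_card_support sum_prod_fin_one_one sum_monomial_chainPt vert_sum_fin_zero
   vert_sum_fin_zero')

noncomputable section

/-! ## §0 Probe: the crux by name; the budget is never below `1`; degenerate corners -/

/-- The crux, by name, is literally the ROOT KPTT bound on `vert (Σ_i Π_j f i j)`. -/
theorem newtonTauRoot_iff :
    NewtonTauRoot ↔ ∃ a b : ℕ, ∀ (k m t : ℕ) (f : Fin k → Fin m → MvPolynomial (Fin 2) ℂ),
      (∀ i j, (f i j).support.card ≤ t) →
        vert (∑ i, ∏ j, f i j) ≤ 2 ^ (a * m) * (k * t + 2) ^ (b * (Nat.sqrt m + 1)) :=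
  Iff.rfl

/-- The root budget is at least `1` for all parameters (so `vert ≤ 1` corners are harmless). -/
theorem one_le_rootBound (a b k m t : ℕ) :
    1 ≤ 2 ^ (a * m) * (k * t + 2) ^ (b * (Nat.sqrt m + 1)) :=
  Nat.succ_le_of_lt (by positivity)

/-- Corner `k = 0`: the empty sum is `0`, `vert = 0`, inside the budget for every `a b`. -/
theorem vert_le_rootBound_of_k_zero (a b m t : ℕ) (f : Fin 0 → Fin m → MvPolynomial (Fin 2) ℂ) :
    vert (∑ i, ∏ j, f i j) ≤ 2 ^ (a * m) * (0 * t + 2) ^ (b * (Nat.sqrt m + 1)) := by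
  rw [vert_sum_fin_zero]
  exact Nat.zero_le _

/-- Corner `m = 0`: every product is `1`, the sum is the constant `k`, `vert ≤ 1`, inside the budget
for every `a b`. -/
theorem vert_le_rootBound_of_m_zero (a b k t : ℕ) (f : Fin k → Fin 0 → MvPolynomial (Fin 2) ℂ) :
    vert (∑ i, ∏ j, f i j) ≤ 2 ^ (a * 0) * (k * t + 2) ^ (b * (Nat.sqrt 0 + 1)) :=
  (vert_sum_fin_zero' k f).trans (one_le_rootBound a b k 0 t)

/-! ## §E Hierarchy, negative direction: a kill of the root form kills the sharp form -/

/-- `NewtonTauWeak → NewtonTauRoot` with the same constants (`(kt+2)^b ≤ (kt+2)^{b(⌊√m⌋+1)}`), stated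
contrapositively: refuting the root form refutes the sharp form `NewtonTauWeak` (stmt-5904) and hence
KPTT's Conjecture 1. -/
theorem not_newtonTauWeak_of_not_newtonTauRoot (h : ¬ NewtonTauRoot) : ¬ NewtonTauWeak := by
  rintro ⟨a, b, hw⟩
  refine h ⟨a, b, fun k m t f hf => (hw k m t f hf).trans ?_⟩
  apply Nat.mul_le_mul_left
  apply Nat.pow_le_pow_right (by omega)
  exact Nat.le_mul_of_pos_right _ (Nat.succ_pos _)

/-! ## §A Load-bearing: the sparsity hypothesis -/

/-- The crux with its only hypothesis `∀ i j, #supp (f i j) ≤ t` DELETED (so `t` is free). -/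
def NewtonTauRootWithoutSparsity : Prop :=
  ∃ a b : ℕ, ∀ (k m t : ℕ) (f : Fin k → Fin m → MvPolynomial (Fin 2) ℂ),
    vert (∑ i, ∏ j, f i j) ≤ 2 ^ (a * m) * (k * t + 2) ^ (b * (Nat.sqrt m + 1))

/-- `⌊√1⌋ = 1`. -/
theorem sqrt_one : Nat.sqrt 1 = 1 := Nat.sqrt_eq' 1

/-- **Load-bearing: any proof must use the sparsity hypothesis.**  Without it take `k = m = 1`, `t = 0`:
the budget is `2^a · 2^{2b} = 2^a · 4^b`, and the single factor `chainPoly (range (2^a·4^b + 1))`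
(monomials on a strictly convex lattice chain) has `2^a·4^b + 1` vertices. -/
theorem newtonTauRoot_false_without_sparsity : ¬ NewtonTauRootWithoutSparsity := by
  rintro ⟨a, b, h⟩
  have hle := h 1 1 0 (fun _ _ => chainPoly (range (2 ^ a * 4 ^ b + 1)))
  rw [sum_prod_fin_one_one] at hle
  change (Set.extremePoints ℝ (convexHull ℝ ((fun e : Fin 2 →₀ ℕ => fun i : Fin 2 => ((e i : ℕ) : ℝ)) ''
      ((chainPoly (range (2 ^ a * 4 ^ b + 1))).support : Set (Fin 2 →₀ ℕ))))).ncard ≤ _ at hle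
  rw [vertices_chainPoly, Finset.card_range] at hle
  have h4 : (1 * 0 + 2) ^ (b * (Nat.sqrt 1 + 1)) = 4 ^ b := by
    rw [sqrt_one, show b * (1 + 1) = 2 * b by ring, pow_mul]
    norm_num
  rw [h4, mul_one] at hle
  omega

/-! ## §B Shape of the budget: `k` and `t` are indispensable in the base even with exponent `b(⌊√m⌋+1)` -/

/-- The root bound with the `k`-dependence removed from the base. -/
def NewtonTauRootBoundNoK : Prop :=
  ∃ a b : ℕ, ∀ (k m t : ℕ) (f : Fin k → Fin m → MvPolynomial (Fin 2) ℂ),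
    (∀ i j, (f i j).support.card ≤ t) →
      vert (∑ i, ∏ j, f i j) ≤ 2 ^ (a * m) * (t + 2) ^ (b * (Nat.sqrt m + 1))

/-- The root bound with the `t`-dependence removed from the base. -/
def NewtonTauRootBoundNoT : Prop :=
  ∃ a b : ℕ, ∀ (k m t : ℕ) (f : Fin k → Fin m → MvPolynomial (Fin 2) ℂ),
    (∀ i j, (f i j).support.card ≤ t) →
      vert (∑ i, ∏ j, f i j) ≤ 2 ^ (a * m) * (k + 2) ^ (b * (Nat.sqrt m + 1))

/-- **`k` is indispensable**: with `m = t = 1` and `k` monomials on a strictly convex chain (one per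
summand) the vertex count is `k`, unbounded against the budget `2^a · 3^{2b} = 2^a · 9^b`. -/
theorem not_newtonTauRootBoundNoK : ¬ NewtonTauRootBoundNoK := by
  rintro ⟨a, b, h⟩
  set K := 2 ^ a * 9 ^ b + 1 with hK
  have hle := h K 1 1 (fun i _ => monomial (chainPt (i : ℕ)) 1) (fun i j => by
    exact (Finset.card_le_card support_monomial_subset).trans (by simp))
  rw [sum_monomial_chainPt] at hle
  change (Set.extremePoints ℝ (convexHull ℝ ((fun e : Fin 2 →₀ ℕ => fun i : Fin 2 => ((e i : ℕ) : ℝ)) ''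
      ((chainPoly (range K)).support : Set (Fin 2 →₀ ℕ))))).ncard ≤ _ at hle
  rw [vertices_chainPoly, Finset.card_range] at hle
  have h9 : (1 + 2) ^ (b * (Nat.sqrt 1 + 1)) = 9 ^ b := by
    rw [sqrt_one, show b * (1 + 1) = 2 * b by ring, pow_mul]
    norm_num
  rw [h9, mul_one] at hle
  omega

/-- **`t` is indispensable**: with `k = m = 1` and one `t`-nomial on a strictly convex chain the vertex
count is `t`, unbounded against the budget `2^a · 9^b`. -/
theorem not_newtonTauRootBoundNoT : ¬ NewtonTauRootBoundNoT := by
  rintro ⟨a, b, h⟩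
  set N := 2 ^ a * 9 ^ b + 1 with hN
  have hle := h 1 1 N (fun _ _ => chainPoly (range N)) (fun _ _ => by
    rw [support_chainPoly, Finset.card_image_of_injective _ chainPt_injective, Finset.card_range])
  rw [sum_prod_fin_one_one] at hle
  change (Set.extremePoints ℝ (convexHull ℝ ((fun e : Fin 2 →₀ ℕ => fun i : Fin 2 => ((e i : ℕ) : ℝ)) ''
      ((chainPoly (range N)).support : Set (Fin 2 →₀ ℕ))))).ncard ≤ _ at hle
  rw [vertices_chainPoly, Finset.card_range] at hle
  have h9 : (1 + 2) ^ (b * (Nat.sqrt 1 + 1)) = 9 ^ b := by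
    rw [sqrt_one, show b * (1 + 1) = 2 * b by ring, pow_mul]
    norm_num
  rw [h9, mul_one] at hle
  omega

end

end Summit.ValiantsHypothesis.ValiantsHypothesis.Theorems.NewtonTauRoot.Negative
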